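import Mathlib
import Summits.NavierStokesRegularity.NavierStokesRegularity.Theorems.FilamentSkeletonRssTangentSkeletonNearStraightLiaSymbol
import Literature.NumberTheory.Automorphic.ModularEisensteinContinuation

/-!
# Clause 13-J/13-R, brick B5 (band window, ANALYTIC PART): the derivative of the self-induction symbol in closed form,
# `𝔖′(x) = (x/2)·(2C(p) − E(p))`, `p = x²/4`  (equivalently `𝔖′ = x²K₁(x) − xK₀(x)`)

Route `FilamentSkeletonRss`, ∃-side clause 13 (`Clause13RNearStraightL` stmt-NavierStokesRegularity-23612; typing-agnostic); design
`filament-plan/DESIGN-28296-model-gluing-g16.md` §4 n1b.  The band window of the model gluing (Mourre estimate `model_band_estimate`, p694551) needs a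
certified LOWER bound on `𝔖′`; the tree knows `𝔖′` only through a Fourier representation (`hasDerivAt_liaSym`, p685720) and the bound `|𝔖′| ≤ π`.
Here `𝔖′` is expressed through the two integrals `C(p) = ∫₀^∞e^{−t}e^{−p/t}dt`, `E(p) = ∫₀^∞e^{−t}e^{−p/t}dt/t` of the certified-numerics machinery
(`…AnalyticStripLiaSymbolNumericsDefs`, lane g12), whose bracket sums then certify the sign (`…Clause13LiaSymbolDerivWindow`):

* §1 `hasDerivAt_Cint` — `C′(p) = −E(p)`;  `hasDerivAt_Eint` — `E′(p) = −E₂(p)`, `E₂(p) = ∫₀^∞e^{−t}e^{−p/t}dt/t²` (differentiation under the integral,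
  dominated near `p₀ > 0` by the integrands at `p₀/2`; `e^{−c/t}/t² ≤ 2/c²` via the tree's `Literature.NumberTheory.Automorphic.exp_neg_le_two_div_sq`);
* §2 `integral_E2_eq` — the substitution `t ↦ p/t`: `E₂(p) = C(p)/p`;
* §3 `hasDerivAt_Phi` — `Φ′(p) = 2C(p) − E(p)` for `Φ = 1 − C − 2pE`;  `hasDerivAt_liaSym_closedForm` / `deriv_liaSym_eq` — for `x > 0`,
  `𝔖′(x) = (x/2)(2C(x²/4) − E(x²/4))` (chain rule through `liaSym_eq_Phi`, p656939).
Lane ns-filament-19175-p1 g16; `--supports stmt-NavierStokesRegularity-23612 --as helper`.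
HONEST FRAMING: calculus for one explicit real integral, serving a HYPOTHETICAL filament-skeleton line on the NEGATIVE side of a MODEL route; nothing here
bears on Navier–Stokes regularity or blow-up.
-/

set_option linter.dupNamespace false

noncomputable section

namespace Summit.NavierStokesRegularity.NavierStokesRegularity.Theorems.AnalyticStripLiaSymbol

open Real Set MeasureTheory Filter Topology Metric

namespace Numerics

/-! ## §1 Differentiation under the integral sign -/

/-- The `E₂`-integrand `e^{−t}e^{−p/t}/t²` is integrable on `(0,∞)` for `p > 0` (it is `≤ (2/p²)e^{−t}`). [folklore] -/
theorem integrableOn_E2_integrand {p : ℝ} (hp : 0 < p) :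
    IntegrableOn (fun t : ℝ => Real.exp (-t) * Real.exp (-(p / t)) / t ^ 2) (Ioi 0) := by
  refine ((integrableOn_exp_neg_Ioi 0).const_mul (2 / p ^ 2)).mono' ?_ ?_
  · exact (((Real.measurable_exp.comp measurable_neg).mul
      (Real.measurable_exp.comp (measurable_const.div measurable_id).neg)).div (measurable_id.pow_const 2)).aestronglyMeasurable
  · rw [ae_restrict_iff' measurableSet_Ioi]
    refine Filter.Eventually.of_forall fun t (ht : 0 < t) => ?_
    rw [Real.norm_eq_abs, abs_of_nonneg (by positivity)]
    have hy : 0 < p / t := div_pos hp ht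
    have h1 : Real.exp (-(p / t)) ≤ 2 / (p / t) ^ 2 := Literature.NumberTheory.Automorphic.exp_neg_le_two_div_sq hy
    have h2 : Real.exp (-(p / t)) / t ^ 2 ≤ 2 / p ^ 2 := by
      rw [div_le_iff₀ (by positivity)]
      calc Real.exp (-(p / t)) ≤ 2 / (p / t) ^ 2 := h1
        _ = 2 / p ^ 2 * t ^ 2 := by field_simp
    calc Real.exp (-t) * Real.exp (-(p / t)) / t ^ 2 = Real.exp (-t) * (Real.exp (-(p / t)) / t ^ 2) := by ring
      _ ≤ Real.exp (-t) * (2 / p ^ 2) := by gcongr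
      _ = 2 / p ^ 2 * Real.exp (-t) := by ring

/-- Pointwise derivative in `p` of the `C`-integrand. [folklore] -/
theorem hasDerivAt_fC_param (t p : ℝ) :
    HasDerivAt (fun p : ℝ => Real.exp (-t) * Real.exp (-(p / t))) (-(Real.exp (-t) * Real.exp (-(p / t)) / t)) p := by
  have h1 : HasDerivAt (fun p : ℝ => -(p / t)) (-(1 / t)) p := by
    have h := (hasDerivAt_id p).const_mul (-(1 / t))
    have e : (fun q : ℝ => -(1 / t) * id q) = fun q => -(q / t) := by
      funext q; simp only [id_eq]; ring
    rw [e, mul_one] at h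
    exact h
  have h2 : HasDerivAt (fun p : ℝ => Real.exp (-(p / t))) (Real.exp (-(p / t)) * (-(1 / t))) p := h1.exp
  have h3 := h2.const_mul (Real.exp (-t))
  exact h3.congr_deriv (by ring)

/-- Pointwise derivative in `p` of the `E`-integrand. [folklore] -/
theorem hasDerivAt_fE_param (t p : ℝ) :
    HasDerivAt (fun p : ℝ => Real.exp (-t) * Real.exp (-(p / t)) / t) (-(Real.exp (-t) * Real.exp (-(p / t)) / t ^ 2)) p :=
  ((hasDerivAt_fC_param t p).div_const t).congr_deriv (by ring)

/-- **`C′(p) = −E(p)`** for `p > 0`. [folklore] -/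
theorem hasDerivAt_Cint {p₀ : ℝ} (hp₀ : 0 < p₀) : HasDerivAt Cint (-Eint p₀) p₀ := by
  have hε : 0 < p₀ / 2 := half_pos hp₀
  have key := hasDerivAt_integral_of_dominated_loc_of_deriv_le (μ := volume.restrict (Ioi (0:ℝ)))
    (F := fun p t => Real.exp (-t) * Real.exp (-(p / t))) (F' := fun p t => -(Real.exp (-t) * Real.exp (-(p / t)) / t))
    (x₀ := p₀) (bound := fun t => Real.exp (-t) * Real.exp (-((p₀ / 2) / t)) / t) (s := Ioi (p₀ / 2))
    (Ioi_mem_nhds (by linarith)) ?_ ?_ ?_ ?_ ?_ ?_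
  · have h := key.2
    rw [show -Eint p₀ = ∫ t in Ioi (0:ℝ), -(Real.exp (-t) * Real.exp (-(p₀ / t)) / t) by
      rw [integral_neg]; rfl]
    exact h
  · filter_upwards [Ioi_mem_nhds (by linarith : p₀ / 2 < p₀)] with p (hp : p₀ / 2 < p)
    exact (integrableOn_fC (hε.le.trans hp.le)).aestronglyMeasurable
  · exact integrableOn_fC hp₀.le
  · exact (integrableOn_E_integrand hp₀).neg.aestronglyMeasurable
  · rw [ae_restrict_iff' measurableSet_Ioi]
    refine Filter.Eventually.of_forall fun t (ht : 0 < t) p (hp : p₀ / 2 < p) => ?_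
    rw [norm_neg, Real.norm_eq_abs, abs_of_nonneg (by positivity)]
    gcongr
  · exact integrableOn_E_integrand hε
  · exact Filter.Eventually.of_forall fun t p _ => hasDerivAt_fC_param t p

/-- **`E′(p) = −E₂(p)`**, `E₂(p) = ∫₀^∞ e^{−t}e^{−p/t}dt/t²`, for `p > 0`. [folklore] -/
theorem hasDerivAt_Eint {p₀ : ℝ} (hp₀ : 0 < p₀) :
    HasDerivAt Eint (-(∫ t in Ioi (0:ℝ), Real.exp (-t) * Real.exp (-(p₀ / t)) / t ^ 2)) p₀ := by
  have hε : 0 < p₀ / 2 := half_pos hp₀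
  have key := hasDerivAt_integral_of_dominated_loc_of_deriv_le (μ := volume.restrict (Ioi (0:ℝ)))
    (F := fun p t => Real.exp (-t) * Real.exp (-(p / t)) / t) (F' := fun p t => -(Real.exp (-t) * Real.exp (-(p / t)) / t ^ 2))
    (x₀ := p₀) (bound := fun t => Real.exp (-t) * Real.exp (-((p₀ / 2) / t)) / t ^ 2) (s := Ioi (p₀ / 2))
    (Ioi_mem_nhds (by linarith)) ?_ ?_ ?_ ?_ ?_ ?_
  · have h := key.2
    rw [show -(∫ t in Ioi (0:ℝ), Real.exp (-t) * Real.exp (-(p₀ / t)) / t ^ 2)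
        = ∫ t in Ioi (0:ℝ), -(Real.exp (-t) * Real.exp (-(p₀ / t)) / t ^ 2) by rw [integral_neg]]
    exact h
  · filter_upwards [Ioi_mem_nhds (by linarith : p₀ / 2 < p₀)] with p (hp : p₀ / 2 < p)
    exact (integrableOn_E_integrand (hε.trans hp)).aestronglyMeasurable
  · exact integrableOn_E_integrand hp₀
  · exact (integrableOn_E2_integrand hp₀).neg.aestronglyMeasurable
  · rw [ae_restrict_iff' measurableSet_Ioi]
    refine Filter.Eventually.of_forall fun t (ht : 0 < t) p (hp : p₀ / 2 < p) => ?_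
    rw [norm_neg, Real.norm_eq_abs, abs_of_nonneg (by positivity)]
    gcongr
  · exact integrableOn_E2_integrand hε
  · exact Filter.Eventually.of_forall fun t p _ => hasDerivAt_fE_param t p

/-! ## §2 The substitution `t ↦ p/t`: `E₂(p) = C(p)/p` -/

/-- **`∫₀^∞ e^{−t}e^{−p/t}dt/t² = C(p)/p`** for `p > 0` (substitute `t = 1/x`, then `x = u/p`). [folklore] -/
theorem integral_E2_eq {p : ℝ} (hp : 0 < p) :
    ∫ t in Ioi (0:ℝ), Real.exp (-t) * Real.exp (-(p / t)) / t ^ 2 = Cint p / p := by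
  -- step 1: `t = x⁻¹` in `C`: `C(p) = ∫ x^{-2} e^{-1/x} e^{-p x} dx`
  have h1 := integral_comp_rpow_Ioi (fun y : ℝ => Real.exp (-y) * Real.exp (-(p / y))) (p := (-1 : ℝ)) (by norm_num)
  have h1' : ∫ x in Ioi (0:ℝ), x ^ (-2 : ℝ) * (Real.exp (-x⁻¹) * Real.exp (-(p * x))) = Cint p := by
    unfold Cint
    rw [← h1]
    refine setIntegral_congr_fun measurableSet_Ioi fun x (hx : 0 < x) => ?_
    simp only [smul_eq_mul]
    rw [show |(-1:ℝ)| = 1 by norm_num, one_mul, show (-1 : ℝ) - 1 = -2 by norm_num, Real.rpow_neg_one,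
      div_inv_eq_mul]
  -- step 2: `x = u/p`
  have h2 := integral_comp_mul_left_Ioi (fun u : ℝ => Real.exp (-u) * Real.exp (-(p / u)) / u ^ 2) 0 hp
  rw [mul_zero] at h2
  have h2' : ∫ x in Ioi (0:ℝ), (fun u : ℝ => Real.exp (-u) * Real.exp (-(p / u)) / u ^ 2) (p * x)
      = p⁻¹ ^ 2 * ∫ x in Ioi (0:ℝ), x ^ (-2 : ℝ) * (Real.exp (-x⁻¹) * Real.exp (-(p * x))) := by
    rw [← integral_const_mul]
    refine setIntegral_congr_fun measurableSet_Ioi fun x (hx : 0 < x) => ?_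
    simp only
    have hx0 : x ≠ 0 := hx.ne'
    have e1 : p / (p * x) = x⁻¹ := by field_simp
    have e2 : x ^ (-2:ℝ) = (x ^ 2)⁻¹ := by rw [Real.rpow_neg hx.le, Real.rpow_two]
    rw [e1, e2]
    field_simp
  rw [h2', h1', smul_eq_mul] at h2
  -- `p⁻² C = p⁻¹ E₂`
  have hp0 : p ≠ 0 := hp.ne'
  field_simp at h2
  field_simp
  linarith [h2]

/-! ## §3 `Φ′ = 2C − E` and the closed form of `𝔖′` -/

/-- **`Φ′(p) = 2C(p) − E(p)`** for `p > 0`, `Φ = 1 − C − 2pE`. [folklore] -/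
theorem hasDerivAt_Phi {p : ℝ} (hp : 0 < p) : HasDerivAt Phi (2 * Cint p - Eint p) p := by
  have hC := hasDerivAt_Cint hp
  have hE := hasDerivAt_Eint hp
  rw [integral_E2_eq hp] at hE
  have hpE : HasDerivAt (fun q : ℝ => 2 * q * Eint q) (2 * 1 * Eint p + 2 * p * (-(Cint p / p))) p := by
    have h1 : HasDerivAt (fun q : ℝ => 2 * q) (2 * 1) p := (hasDerivAt_id p).const_mul 2
    exact h1.mul hE
  have h : HasDerivAt (fun q : ℝ => 1 - Cint q - 2 * q * Eint q) (-(-Eint p) - (2 * 1 * Eint p + 2 * p * (-(Cint p / p)))) p :=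
    (hC.const_sub 1).fun_sub hpE
  have e : (fun q : ℝ => 1 - Cint q - 2 * q * Eint q) = Phi := by funext q; rfl
  rw [e] at h
  refine h.congr_deriv ?_
  field_simp
  ring

/-- **Closed form of `𝔖′`**: for `x > 0`, `𝔖` has derivative `(x/2)·(2C(x²/4) − E(x²/4))` at `x`. [folklore] -/
theorem hasDerivAt_liaSym_closedForm {x : ℝ} (hx : 0 < x) :
    HasDerivAt liaSym (x / 2 * (2 * Cint (x ^ 2 / 4) - Eint (x ^ 2 / 4))) x := by
  have hp : 0 < x ^ 2 / 4 := by positivity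
  have hinner : HasDerivAt (fun y : ℝ => y ^ 2 / 4) (x / 2) x := by
    have h := (hasDerivAt_pow 2 x).div_const 4
    refine h.congr_deriv ?_
    norm_num
    ring
  have hcomp : HasDerivAt (fun y : ℝ => Phi (y ^ 2 / 4)) ((2 * Cint (x ^ 2 / 4) - Eint (x ^ 2 / 4)) * (x / 2)) x := by
    have h := (hasDerivAt_Phi hp).comp x hinner
    simpa only [Function.comp_def] using h
  have hev : (fun y : ℝ => Phi (y ^ 2 / 4)) =ᶠ[𝓝 x] liaSym := by
    filter_upwards [Ioi_mem_nhds hx] with y (hy : 0 < y)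
    exact (liaSym_eq_Phi y hy.ne').symm
  exact (hcomp.congr_of_eventuallyEq hev.symm).congr_deriv (by ring)

/-- `deriv 𝔖 x = (x/2)(2C(x²/4) − E(x²/4))` for `x > 0`. [folklore] -/
theorem deriv_liaSym_eq {x : ℝ} (hx : 0 < x) :
    deriv liaSym x = x / 2 * (2 * Cint (x ^ 2 / 4) - Eint (x ^ 2 / 4)) :=
  (hasDerivAt_liaSym_closedForm hx).deriv

end Numerics

end Summit.NavierStokesRegularity.NavierStokesRegularity.Theorems.AnalyticStripLiaSymbol

end
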